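import Summits.Ventures.YMGap.RobustBall.UniformRateStrongCoupling
import HarnessLib

/-!
# Venture YMGap, track ROBUST-BALL (Y2) — the Wilson point TWO-SIDED (both signs of `β_W`) with explicit rates, and the
# Literature currency `HasUniformExponentialDecay` for Chatterjee's `f_β` over the balls

HONEST FRAMING. WHAT THIS IS: a venture file (cell `pub-ymgap`, track Y2 ROBUST-BALL, seat rb-p1, theorems only). The single-link doors
depend on `|β_W|` only, so the explicit-rate Wilson-point statements of `UniformMassGapKR.lean` / `UniformRateStrongCoupling.lean` hold for
BOTH SIGNS of the coupling (as the tree's T15 does, there by the sign flip; here directly):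
* `su2_wilson_clustering_abs_le_oneTwelfth` — `|β_W| ≤ 1/12`: EVERY DLR state of `SU(2)` on `ℤ⁴` clusters at rate `log 2`, constant `32 n²`;
  `su2_wilson_hasExponentialDecayRate_plaquetteCorrFn_abs` — `HasExponentialDecayRate (plaquetteCorrFn …) (log 2)` for every
  `μ ∈ ymGibbsMeasures (fundamentalRep (Fin 2)) (β_W/2)`, `|β_W| ≤ 1/12`;
* `su2_wilson_clustering_rate_abs` — `0 < |β_W| < 1/8`: rate `log(1/(8|β_W|))`, constant `16 n²` (logarithmic growth, both signs);
* the Literature's UNIFORM currency for the T14/T15 object: `UniformMassGapOnBallZd/ZdS/ZdG.hasUniformExponentialDecay_plaquetteCorrFn` —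
  the family `(member, DLR state) ↦ plaquetteCorrFn ρ μ` decays at rate `m` with ONE constant (`HasUniformExponentialDecay`).
WHAT THIS IS NOT: Dobrushin-comparison lower bounds; strong-coupling LATTICE statements, nothing about the continuum or a Clay-sense mass gap.
-/

noncomputable section

open MeasureTheory Filter Function ProbabilityTheory Real
open scoped NNReal
open Literature.Probability.LatticeModels
open Literature.Probability.LatticeModels.DobrushinMetric
open Literature.MathematicalPhysics.QuantumLattice
open Literature.MathematicalPhysics.QuantumFieldTheory hiding ZdEdge Site plaquetteObs

namespace Summit.Ventures.YMGap.RobustBall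

/-! ### Two-sided Wilson point, rate `log 2` on `|β_W| ≤ 1/12` -/

/-- **TWO-SIDED WILSON POINT**: for `|β_W| ≤ 1/12`, EVERY DLR state of `SU(2)` lattice Yang–Mills on `ℤ⁴` (bare coupling `β_W/2`) clusters at
rate `log 2` with constant `32 n²`. [folklore] -/
theorem su2_wilson_clustering_abs_le_oneTwelfth {βW : ℝ} (h : |βW| ≤ 1 / 12) :
    PerturbedClustering 4 2 (βW / 4) 0 (fun _ => (∅ : Finset (Finset (ZdEdge 4)))) (Real.log 2) 32 := by
  have hball : UniformMassGapOnBallZd 4 2 (βW / 4) 0 0 0 (Real.log 2 / max 1 0) 32 :=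
    su2_uniformMassGapOnBallZd_dim4_half 0 (by rw [Real.exp_zero, zero_div, Real.exp_zero]; linarith)
  have hmax : (Real.log 2 / max 1 0 : ℝ) = Real.log 2 := by rw [max_eq_left zero_le_one, div_one]
  rw [hmax] at hball
  exact hball.clustering_wilson le_rfl le_rfl

/-- **TWO-SIDED, Chatterjee's `f_β`**: for `|β_W| ≤ 1/12` every `μ ∈ ymGibbsMeasures (fundamentalRep (Fin 2)) (β_W/2)` has
`HasExponentialDecayRate (plaquetteCorrFn … μ) (log 2)` (T15's object with the rate named, both signs). [folklore] -/
theorem su2_wilson_hasExponentialDecayRate_plaquetteCorrFn_abs {βW : ℝ} (h : |βW| ≤ 1 / 12)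
    {μ : Measure (LGConfig 4 (SUN 2))} (hμ : μ ∈ ymGibbsMeasures (d := 4) (fundamentalRep (Fin 2)) (βW / 2)) :
    HasExponentialDecayRate (plaquetteCorrFn (fundamentalRep (Fin 2)) μ) (Real.log 2) := by
  have hμ' : μ ∈ perturbedGibbsMeasures (d := 4) (fundamentalRep (Fin 2)) (2 * (βW / 4)) 0
      (fun _ => (∅ : Finset (Finset (ZdEdge 4)))) := by
    rw [perturbedGibbsMeasures_zero]
    have e : (2 : ℝ) * (βW / 4) = βW / 2 := by ring
    rwa [e]
  exact (su2_wilson_clustering_abs_le_oneTwelfth h).hasExponentialDecayRate_plaquetteCorrFn (N := 2) (by norm_num)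
    (Real.log_pos one_lt_two) hμ'

/-! ### Two-sided logarithmic rate on `0 < |β_W| < 1/8` -/

/-- **TWO-SIDED LOGARITHMIC RATE**: for `0 < |β_W| < 1/8`, every DLR state of `SU(2)` on `ℤ⁴` clusters at rate `log(1/(8|β_W|))`, constant
`16 n²`. [folklore] -/
theorem su2_wilson_clustering_rate_abs {βW : ℝ} (h0 : 0 < |βW|) (h : |βW| < 1 / 8) :
    PerturbedClustering 4 2 (βW / 4) 0 (fun _ => (∅ : Finset (Finset (ZdEdge 4)))) (Real.log (1 / (8 * |βW|))) 16 := by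
  have hq0 : 0 < 1 / (8 * |βW|) := by positivity
  have hq : 1 < 1 / (8 * |βW|) := by rw [lt_div_iff₀ (by positivity)]; linarith
  have ht : 0 < Real.log (1 / (8 * |βW|)) := Real.log_pos hq
  have hS : UniformMassGapOnBallZdS 4 2 (βW / 4) 0 0 (Real.log (1 / (8 * |βW|))) (Real.log (1 / (8 * |βW|))) 16 := by
    refine su2_uniformMassGapOnBallZdS_dim4 ht ?_
    rw [Real.exp_log hq0, Real.exp_zero, zero_div, Real.exp_zero]
    have e : 6 * |βW| * (1 * (1 / (8 * |βW|))) = 3 / 4 := by field_simp; ring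
    rw [e]; norm_num
  have hZd : UniformMassGapOnBallZd 4 2 (βW / 4) 0 0 0 (Real.log (1 / (8 * |βW|))) 16 :=
    hS.uniformMassGapOnBallZd ht.le le_rfl (by simp)
  exact hZd.clustering_wilson le_rfl le_rfl

/-- **Two-sided, Chatterjee's `f_β` at the logarithmic rate**: `0 < |β_W| < 1/8` ⇒ every `μ ∈ ymGibbsMeasures … (β_W/2)` has
`HasExponentialDecayRate (plaquetteCorrFn … μ) (log(1/(8|β_W|)))`. [folklore] -/
theorem su2_wilson_hasExponentialDecayRate_plaquetteCorrFn_rate_abs {βW : ℝ} (h0 : 0 < |βW|) (h : |βW| < 1 / 8)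
    {μ : Measure (LGConfig 4 (SUN 2))} (hμ : μ ∈ ymGibbsMeasures (d := 4) (fundamentalRep (Fin 2)) (βW / 2)) :
    HasExponentialDecayRate (plaquetteCorrFn (fundamentalRep (Fin 2)) μ) (Real.log (1 / (8 * |βW|))) := by
  have hμ' : μ ∈ perturbedGibbsMeasures (d := 4) (fundamentalRep (Fin 2)) (2 * (βW / 4)) 0
      (fun _ => (∅ : Finset (Finset (ZdEdge 4)))) := by
    rw [perturbedGibbsMeasures_zero]
    have e : (2 : ℝ) * (βW / 4) = βW / 2 := by ring
    rwa [e]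
  exact (su2_wilson_clustering_rate_abs h0 h).hasExponentialDecayRate_plaquetteCorrFn (N := 2) (by norm_num)
    (Real.log_pos (by rw [lt_div_iff₀ (by positivity)]; linarith)) hμ'

/-! ### `HasUniformExponentialDecay` for `plaquetteCorrFn` over the balls (`d = 4`) -/

section Balls

variable {N : ℕ} {β ε₀ ε₁ R a Λ t m A : ℝ}

/-- **Literature currency for the T14/T15 object, tier-1 ball**: the family `(member of MemBallZd ε₀ ε₁ R, DLR state) ↦ plaquetteCorrFn ρ μ`
decays exponentially at rate `m` UNIFORMLY in the index (`HasUniformExponentialDecay`: one constant for the whole ball). [folklore] -/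
theorem UniformMassGapOnBallZd.hasUniformExponentialDecay_plaquetteCorrFn (hN : 1 ≤ N) (h : UniformMassGapOnBallZd 4 N β ε₀ ε₁ R m A) :
    HasUniformExponentialDecay
      (fun p : {p : (Potential (ZdEdge 4) (SUN N) × (Finset (ZdEdge 4) → Finset (Finset (ZdEdge 4)))) × Measure (LGConfig 4 (SUN N)) //
          MemBallZd ε₀ ε₁ R p.1.1 p.1.2 ∧ p.2 ∈ perturbedGibbsMeasures (d := 4) (fundamentalRep (Fin N)) (N * β) p.1.1 p.1.2} =>
        plaquetteCorrFn (fundamentalRep (Fin N)) p.1.2) m := by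
  refine ⟨h.1, (N : ℝ) ^ 2 * max (max (A * (4 : ℕ) ^ 2) 0 * Real.exp (2 * m) *
      (((4 * (N : ℝ≥0) ^ 3 : ℝ≥0) : ℝ) * ((4 * (N : ℝ≥0) ^ 3 : ℝ≥0) : ℝ) + 1)) (4 * Real.exp (2 * m)), fun p x => ?_⟩
  have hμ' : IsGibbsMeasure (perturbedYM (d := 4) (fundamentalRep (Fin N)) (N * β) p.1.1.1 p.1.1.2) p.1.2 := p.2.2
  haveI := hμ'.isProbabilityMeasure
  have h01 : (0 : Fin 4) < 1 := by decide
  have hb := h.abs_cov_plaquette_le p.2.1 p.2.2 0 x h01 h01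
  rw [zero_sub, norm_neg] at hb
  dsimp only
  rw [plaquetteCorrFn_eq_sq_mul_cov hN p.1.2 x, abs_mul, abs_pow, Nat.abs_cast, mul_assoc]
  exact mul_le_mul_of_nonneg_left hb (by positivity)

/-- **Literature currency, tier-2 ball.** [folklore] -/
theorem UniformMassGapOnBallZdS.hasUniformExponentialDecay_plaquetteCorrFn (hN : 1 ≤ N) (h : UniformMassGapOnBallZdS 4 N β a Λ t m A) :
    HasUniformExponentialDecay
      (fun p : {p : Potential (ZdEdge 4) (SUN N) × Measure (LGConfig 4 (SUN N)) //
          MemBallZdS a Λ t p.1 ∧ p.2 ∈ perturbedGibbsMeasuresS (d := 4) (fundamentalRep (Fin N)) (N * β) p.1} =>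
        plaquetteCorrFn (fundamentalRep (Fin N)) p.1.2) m := by
  refine ⟨h.1, (N : ℝ) ^ 2 * max (max (A * (4 : ℕ) ^ 2) 0 * Real.exp (2 * m) *
      (((4 * (N : ℝ≥0) ^ 3 : ℝ≥0) : ℝ) * ((4 * (N : ℝ≥0) ^ 3 : ℝ≥0) : ℝ) + 1)) (4 * Real.exp (2 * m)), fun p x => ?_⟩
  have hμ' : IsGibbsMeasure (perturbedYMS (d := 4) (fundamentalRep (Fin N)) (N * β) p.1.1) p.1.2 := p.2.2
  haveI := hμ'.isProbabilityMeasure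
  have h01 : (0 : Fin 4) < 1 := by decide
  have hb := h.abs_cov_plaquette_le p.2.1 p.2.2 0 x h01 h01
  rw [zero_sub, norm_neg] at hb
  dsimp only
  rw [plaquetteCorrFn_eq_sq_mul_cov hN p.1.2 x, abs_mul, abs_pow, Nat.abs_cast, mul_assoc]
  exact mul_le_mul_of_nonneg_left hb (by positivity)

/-- **Literature currency, ds-2's gauge ball.** [folklore] -/
theorem UniformMassGapOnBallZdG.hasUniformExponentialDecay_plaquetteCorrFn (hN : 1 ≤ N) {R : ℕ}
    (h : UniformMassGapOnBallZdG 4 N β ε₀ ε₁ R m A) :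
    HasUniformExponentialDecay
      (fun p : {p : (Potential (ZdEdge 4) (SUN N) × (Finset (ZdEdge 4) → Finset (Finset (ZdEdge 4)))) × Measure (LGConfig 4 (SUN N)) //
          MemBallZdG ε₀ ε₁ R p.1.1 p.1.2 ∧ p.2 ∈ perturbedGibbsMeasures (d := 4) (fundamentalRep (Fin N)) (N * β) p.1.1 p.1.2} =>
        plaquetteCorrFn (fundamentalRep (Fin N)) p.1.2) m := by
  refine ⟨h.1, (N : ℝ) ^ 2 * max (max (A * (4 : ℕ) ^ 2) 0 * Real.exp (2 * m) *
      (((4 * (N : ℝ≥0) ^ 3 : ℝ≥0) : ℝ) * ((4 * (N : ℝ≥0) ^ 3 : ℝ≥0) : ℝ) + 1)) (4 * Real.exp (2 * m)), fun p x => ?_⟩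
  have hμ' : IsGibbsMeasure (perturbedYM (d := 4) (fundamentalRep (Fin N)) (N * β) p.1.1.1 p.1.1.2) p.1.2 := p.2.2
  haveI := hμ'.isProbabilityMeasure
  have h01 : (0 : Fin 4) < 1 := by decide
  have hb := h.abs_cov_plaquette_le p.2.1 p.2.2 0 x h01 h01
  rw [zero_sub, norm_neg] at hb
  dsimp only
  rw [plaquetteCorrFn_eq_sq_mul_cov hN p.1.2 x, abs_mul, abs_pow, Nat.abs_cast, mul_assoc]
  exact mul_le_mul_of_nonneg_left hb (by positivity)

end Balls

end Summit.Ventures.YMGap.RobustBall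

end
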